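import Summits.QuantumFields.BalabanUV.Beta.GAN24.OneStepConstraintAxialDelKVolumeEnds
import Summits.QuantumFields.BalabanUV.Beta.GAN24.OneStepConstraintAxialDelKLimit
import Summits.QuantumFields.BalabanUV.Beta.GAN24.DiagramDecayWindow

/-!
# `BalabanUV.Beta.GAN24.OneStepConstraintAxialDelKInputTriple` — binder row G-an2-4 ∕ (CONV-C), routes C-R6° («VALUES») × R7 («TWO CURRENCIES»), PART 193:
# THE GAUGE-FIXED ONE-LOOP LETTER IS AN INPUT TRIPLE.  Route R7's currency for everything that enters the loop contraction (PART 156 `mul_inputs`, PARTs 150 ∕ 153) is a volume-indexed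
# TOWER `X_t k` of complex matrices on the unit index set `idx L M_t 0` of NE2's averaged tower, carrying (UD) `EntryDecay (distK L M_t) (X_t k) B κ`, (SR) `TwoLevelDecayRate (distK L M_t)
# (X_t) B′ κ θ` and EL₂ at the readings `(unitIdx L M_t)⁻¹(ẑ,μ)`.  This file reads the gauge-fixed fluctuation covariance of the one-loop step along the tower `n = L^k` on the unit torus
# `M_t = fine (Lb·1) (cubic (d+1) (s t))` — `X_t k = 𝒢_{L^k,t} ⊗ ℂ ∘ (unitIdx, unitIdx)` — in exactly that currency: (UD)+(SR) from PART 184's one pair `(κ, C)` (block-distance decay IS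
# unit-distance decay at rate `κ∕Lb`, PART 181's `cast_mul_tdist_par_le`; `n⁻² = (L⁻²)^k` along the tower) and EL₂ from PART 191 — every `L, Lb ≥ 1`, all `a, a′ > 0`, every `d + 1 ≥ 2`,
# NO RESIDUAL HYPOTHESIS; so `Y = c⁻¹𝒢c⁻¹` and the loop contraction of census V196 (ζ) are now instances of PART 156 ∕ 150 ∕ 153 (unit b2b-balaban-gan24-p3, gen 61; v1)

NOT IN PRINT; OUR PROOF ([folklore] bookkeeping BY NAME over PART 184 `flucCov_DelK_axial_two_levels`, PART 191 `exists_tendsto_flucCov_DelK_axial_castT`, NE2's `cpt_par_add_off_rem`, the β-cell's `castT_liftZ` ∕ `supNorm_liftZ_le_of_castT_eq`, PART 134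
`DiagramDecayWindow.distK_unitIdx_symm`, NE2's `BalabanAveragedTowerUnit` (`lev`, `one_le_lev'`, `cast_lev'`) ∕ `BalabanAveragedCoerciveTower.unitIdx`, `DecayRateInterpolation` (`EntryDecay`,
`TwoLevelDecayRate`); [King1986] Lemma 4.5 (4.38) p. 674 and [Balaban1987RG1] p. 264 (after (1.21)) LOCATE the shapes; nothing printed is a hypothesis).
HONEST FRAMING (cell contract, verbatim): «discharging `BetaPertH` makes Bałaban's UV stability UNCONDITIONAL — a real constructive-QFT result; it is NOT the
continuum limit and NOT the Clay problem.»  HONEST DEPENDENCY (verbatim): «continuum YM on T⁴ ⇐ BetaPertH ∧ nine spine estimates (0/9 proved); BetaPertH ⇐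
(D1) ∧ (D4) ∧ CAP+tail; G-an2-4 gates asym, D1 and NE2/3/4.»

WHAT THIS FILE PROVES (0 sorry, 0 `def`; `M_t = fine (Lb·1) (cubic (d+1) (s t))`, `X_t k = (flucCov (re Δ_{L^k}) Q_ax,t ⊗ ℂ) ∘ (unitIdx L M_t, unitIdx L M_t)`):
* **`tdist_le_mul_tdist_par_add`** (`tdist(x,x′) ≤ R·tdist(par x, par x′) + (R − 1)` — the converse companion of PART 181 `mul_tdist_par_le`), `exp_neg_tdist_par_le_exp_neg_tdist` (block decay ⟹
  unit decay: `e^{−m·tdist(par x, par x′)} ≤ e^{m}·e^{−(m∕R)·tdist(x,x′)}`), `distK_eq_tdist_unitIdx` (King's unit distance = `tdist` of the unit sites).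
* **`exists_flucCov_DelK_axial_inputs`** — `∃ κ > 0, B ≥ 0`: (UD) `∀ t k, EntryDecay (distK L M_t) (X_t k) B κ`; (SR) `∀ t, TwoLevelDecayRate (distK L M_t) X_t B κ (L²)⁻¹`; EL₂ `∀ k μ ν z z′, ∃ s′,
  X_t k ((unitIdx L M_t)⁻¹(ẑ,μ)) ((unitIdx L M_t)⁻¹(ẑ′,ν)) → s′` — the gauge-fixed one-loop letter in route R7's INPUT-triple currency (`d + 1 ≥ 2`, every cubic coarse volume sequence).
WHAT IT IS NOT: `Y = c⁻¹𝒢c⁻¹` and the loop contraction themselves (PART 156 `mul_inputs` with `c_k⁻¹`'s triple, then PARTs 150 ∕ 153 — follower); first-order MODEL framing unchanged.  SUPPLIER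
work; NEVER «G-an2-4 closed»; NOT (CONV-C), NOT D1, NOT `BetaPertH`, NOT continuum, NOT Clay.  Records: `HOME/b2b-balaban-gan24-p3/gen61/README.md`.
-/

noncomputable section

open scoped BigOperators ComplexConjugate Matrix
open Filter Topology Finset Matrix

namespace Summit.QuantumFields.BalabanUV.Beta.GAN24.OneStepConstraintAxialDelKInputTriple

open Literature.MathematicalPhysics.QuantumFieldTheory.Balaban1983to89
open Literature.MathematicalPhysics.QuantumFieldTheory.Balaban1983to89.B5Prop11Plancherel (Tor fine)
open Literature.MathematicalPhysics.QuantumFieldTheory.Balaban1983to89.B5RealFields (reM)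
open Literature.MathematicalPhysics.QuantumFieldTheory.Balaban1983to89.B5G183RateUnitTower (lev)
open Literature.MathematicalPhysics.QuantumFieldTheory.Balaban1983to89.Beta.FreeLegDictionary (cubic)
open Literature.MathematicalPhysics.QuantumFieldTheory.Balaban1983to89.Beta.VectorTails (castT liftZ castT_liftZ)
open Literature.MathematicalPhysics.QuantumFieldTheory.Balaban1983to89.Beta.PoissonInterior (supNorm supNorm_le_iff natAbs_le_supNorm)
open Literature.MathematicalPhysics.QuantumFieldTheory.Balaban1983to89.B5G183RateTorus (cpt)
open Literature.MathematicalPhysics.QuantumFieldTheory.Balaban1983to89.B5G183RateTorusW (off)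
open Literature.MathematicalPhysics.QuantumFieldTheory.Balaban1983to89.Beta.VectorTailsCov (tdist supNorm_liftZ_le_of_castT_eq)
open Literature.MathematicalPhysics.QuantumFieldTheory.Balaban1983to89.Beta.CompositionSingular (flucCov)
open Literature.MathematicalPhysics.QuantumFieldTheory.Balaban1983to89.Beta.BlockEffectiveAction (DelK)
open Summit.QuantumFields.BalabanUV.T4Continuum.BalabanLineAverage (QB)
open Summit.QuantumFields.BalabanUV.T4Continuum.BalabanAveragedTowerModes (par rem cpt_par_add_off_rem)
open Summit.QuantumFields.BalabanUV.T4Continuum.BalabanAveragedTowerUnit (idx one_le_lev' cast_lev' lev_succ')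
open Summit.QuantumFields.BalabanUV.T4Continuum.BalabanAveragedCoerciveTower (unitIdx)
open Summit.QuantumFields.BalabanUV.T4Continuum.CTKingTowerWeights (distK)
open Summit.QuantumFields.BalabanUV.T4Continuum.DecayRateInterpolation (EntryDecay TwoLevelDecayRate)
open Summit.QuantumFields.BalabanUV.Beta.GAN24.DiagramDecayWindow (distK_unitIdx_symm)
open Summit.QuantumFields.BalabanUV.Beta.GAN24.OneStepConstraintAxialDelKLimit (flucCov_DelK_axial_two_levels)
open Summit.QuantumFields.BalabanUV.Beta.GAN24.OneStepConstraintAxialDelKVolumeEnds (exists_tendsto_flucCov_DelK_axial_castT)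

variable {d : ℕ}

/-! ## §1 Two dictionaries: block decay ⟹ unit decay; King's unit distance -/

/-- **`tdist_le_mul_tdist_par_add` — THE FINE-SITE DISTANCE IS DOMINATED BY THE BLOCK DISTANCE**: `tdist(x,x′) ≤ R·tdist(par x, par x′) + (R − 1)` (the integer vector
`R·liftZ(par x′ − par x) + (rem x′ − rem x)` represents `x′ − x`, and the centred lift is minimal — the converse companion of PART 181 `mul_tdist_par_le`). [folklore] -/
theorem tdist_le_mul_tdist_par_add (N R : ℕ) [NeZero N] [NeZero R] (M₁ : Fin (d + 1) → ℕ) [∀ μ, NeZero (M₁ μ)] (x x' : Tor (fine (R * N) M₁)) :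
    tdist x x' ≤ R * tdist (par N R M₁ x) (par N R M₁ x') + (R - 1) := by
  have hR : 0 < R := Nat.pos_of_ne_zero (NeZero.ne R)
  have hcast : castT (fine (R * N) M₁) (fun ν => (R : ℤ) * liftZ (par N R M₁ x' - par N R M₁ x) ν + ((((rem N R M₁ x' ν : ℕ)) : ℤ) - (((rem N R M₁ x ν : ℕ)) : ℤ))) = x' - x := by
    funext ν
    have hu : (((liftZ (par N R M₁ x' - par N R M₁ x) ν : ℤ)) : ZMod (fine N M₁ ν)) = (par N R M₁ x' - par N R M₁ x) ν := by
      have h := congrFun (castT_liftZ (par N R M₁ x' - par N R M₁ x)) ν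
      simpa only [castT] using h
    have hdiv : ((fine N M₁ ν : ℕ) : ℤ) ∣ liftZ (par N R M₁ x' - par N R M₁ x) ν - ((((par N R M₁ x' ν).val : ℕ) : ℤ) - (((par N R M₁ x ν).val : ℕ) : ℤ)) := by
      rw [← ZMod.intCast_zmod_eq_zero_iff_dvd]
      push_cast
      rw [hu, ZMod.natCast_zmod_val, ZMod.natCast_zmod_val, Pi.sub_apply, sub_self]
    obtain ⟨m, hm⟩ := hdiv
    have hx := congrFun (cpt_par_add_off_rem N R M₁ x) ν
    have hx' := congrFun (cpt_par_add_off_rem N R M₁ x') ν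
    simp only [Pi.add_apply, cpt, off] at hx hx'
    simp only [castT, Pi.sub_apply]
    rw [← hx, ← hx']
    have hu' : liftZ (par N R M₁ x' - par N R M₁ x) ν = ((((par N R M₁ x' ν).val : ℕ) : ℤ) - (((par N R M₁ x ν).val : ℕ) : ℤ)) + ((fine N M₁ ν : ℕ) : ℤ) * m := by
      linarith
    rw [hu']
    have hper : ((R : ZMod (fine (R * N) M₁ ν)) * (((fine N M₁ ν : ℕ)) : ZMod (fine (R * N) M₁ ν))) = 0 := by
      have h0 : (((fine (R * N) M₁ ν : ℕ)) : ZMod (fine (R * N) M₁ ν)) = 0 := ZMod.natCast_self _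
      have e : (((fine (R * N) M₁ ν : ℕ)) : ZMod (fine (R * N) M₁ ν)) = (R : ZMod (fine (R * N) M₁ ν)) * (((fine N M₁ ν : ℕ)) : ZMod (fine (R * N) M₁ ν)) := by
        simp only [fine]; push_cast; ring
      rw [← e, h0]
    simp only [fine] at hper ⊢
    push_cast at hper ⊢
    linear_combination (m : ZMod (R * N * M₁ ν)) * hper
  calc tdist x x' = supNorm (liftZ (x' - x)) := rfl
    _ ≤ supNorm (fun ν => (R : ℤ) * liftZ (par N R M₁ x' - par N R M₁ x) ν + ((((rem N R M₁ x' ν : ℕ)) : ℤ) - (((rem N R M₁ x ν : ℕ)) : ℤ))) := supNorm_liftZ_le_of_castT_eq hcast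
    _ ≤ R * tdist (par N R M₁ x) (par N R M₁ x') + (R - 1) := by
        refine supNorm_le_iff.mpr fun ν => ?_
        have h1 : (liftZ (par N R M₁ x' - par N R M₁ x) ν).natAbs ≤ tdist (par N R M₁ x) (par N R M₁ x') := natAbs_le_supNorm _ ν
        have hr : (rem N R M₁ x ν : ℕ) < R := (rem N R M₁ x ν).isLt
        have hr' : (rem N R M₁ x' ν : ℕ) < R := (rem N R M₁ x' ν).isLt
        have h2 : ((R : ℤ) * liftZ (par N R M₁ x' - par N R M₁ x) ν + ((((rem N R M₁ x' ν : ℕ)) : ℤ) - (((rem N R M₁ x ν : ℕ)) : ℤ))).natAbs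
            ≤ R * (liftZ (par N R M₁ x' - par N R M₁ x) ν).natAbs + (R - 1) := by
          refine (Int.natAbs_add_le _ _).trans ?_
          rw [Int.natAbs_mul, Int.natAbs_natCast]
          have h3 : ((((rem N R M₁ x' ν : ℕ)) : ℤ) - (((rem N R M₁ x ν : ℕ)) : ℤ)).natAbs ≤ R - 1 := by omega
          exact Nat.add_le_add_left h3 _
        calc _ ≤ R * (liftZ (par N R M₁ x' - par N R M₁ x) ν).natAbs + (R - 1) := h2
          _ ≤ R * tdist (par N R M₁ x) (par N R M₁ x') + (R - 1) := Nat.add_le_add_right (Nat.mul_le_mul_left R h1) _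

/-- block decay ⟹ unit decay: `e^{−m·tdist(par x, par x′)} ≤ e^{m}·e^{−(m∕R)·tdist(x,x′)}` for `m ≥ 0` (`tdist_le_mul_tdist_par_add`). [folklore] -/
theorem exp_neg_tdist_par_le_exp_neg_tdist (N R : ℕ) [NeZero N] [NeZero R] (M₁ : Fin (d + 1) → ℕ) [∀ μ, NeZero (M₁ μ)] {m : ℝ} (hm : 0 ≤ m)
    (x x' : Tor (fine (R * N) M₁)) :
    Real.exp (-(m * (tdist (par N R M₁ x) (par N R M₁ x') : ℝ))) ≤ Real.exp m * Real.exp (-(m / R * (tdist x x' : ℝ))) := by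
  have hR : (0 : ℝ) < R := by exact_mod_cast Nat.pos_of_ne_zero (NeZero.ne R)
  have hR1 : 1 ≤ R := Nat.pos_of_ne_zero (NeZero.ne R)
  have h := tdist_le_mul_tdist_par_add N R M₁ x x'
  have h' : (tdist x x' : ℝ) ≤ (R : ℝ) * (tdist (par N R M₁ x) (par N R M₁ x') : ℝ) + ((R : ℝ) - 1) := by
    have hc : (((R - 1 : ℕ)) : ℝ) = (R : ℝ) - 1 := by rw [Nat.cast_sub hR1, Nat.cast_one]
    rw [← hc]; exact_mod_cast h
  rw [← Real.exp_add]
  apply Real.exp_le_exp.mpr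
  have h1 : m / R * (tdist x x' : ℝ) ≤ m * (tdist (par N R M₁ x) (par N R M₁ x') : ℝ) + m := by
    have h2 : m / R * (tdist x x' : ℝ) ≤ m / R * ((R : ℝ) * (tdist (par N R M₁ x) (par N R M₁ x') : ℝ) + ((R : ℝ) - 1)) :=
      mul_le_mul_of_nonneg_left h' (div_nonneg hm hR.le)
    have h3 : m / R * ((R : ℝ) * (tdist (par N R M₁ x) (par N R M₁ x') : ℝ) + ((R : ℝ) - 1)) = m * (tdist (par N R M₁ x) (par N R M₁ x') : ℝ) + m * (((R : ℝ) - 1) / R) := by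
      field_simp
    have h4 : m * (((R : ℝ) - 1) / R) ≤ m := by
      have : ((R : ℝ) - 1) / R ≤ 1 := by rw [div_le_one hR]; linarith
      nlinarith
    linarith
  linarith

/-- King's unit distance IS the torus sup-distance of the unit sites: `distK L M x y = tdist (unitIdx x).1 (unitIdx y).1` (PART 134 `distK_unitIdx_symm`). [folklore] -/
theorem distK_eq_tdist_unitIdx (L : ℕ) [NeZero L] (M₁ : Fin (d + 1) → ℕ) [∀ μ, NeZero (M₁ μ)] (x y : idx L M₁ 0) :
    distK L M₁ x y = (tdist ((unitIdx L M₁) x).1 ((unitIdx L M₁) y).1 : ℝ) := by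
  have h := distK_unitIdx_symm L M₁ ((unitIdx L M₁) x).1 ((unitIdx L M₁) y).1 ((unitIdx L M₁) x).2 ((unitIdx L M₁) y).2
  simpa only [Prod.mk.eta, Equiv.symm_apply_apply] using h

/-! ## §2 The gauge-fixed one-loop letter as an INPUT triple -/

section Inputs

variable (L Lb : ℕ) [NeZero L] [NeZero Lb] (a : ℝ) (ha : 0 < a) (s : ℕ → ℕ) [hs0 : ∀ t, NeZero (s t)]

/-- **`exists_flucCov_DelK_axial_inputs` — THE GAUGE-FIXED ONE-LOOP LETTER IN ROUTE R7's INPUT-TRIPLE CURRENCY, NO RESIDUAL HYPOTHESIS**: in dimension `d + 1 ≥ 2`, for all `L, Lb ≥ 1`,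
`a, a′ > 0` and every cubic coarse volume sequence `s t → ∞`, the tower `X_t k = (flucCov (re Δ_{L^k}) Q_ax,t ⊗ ℂ) ∘ (unitIdx, unitIdx)` on `idx L M_t 0` has (UD) `EntryDecay (distK L M_t) (X_t k) B κ`
for all `t, k`, (SR) `TwoLevelDecayRate (distK L M_t) X_t B κ (L²)⁻¹` for all `t`, and EL₂ at every pair of readings `(unitIdx L M_t)⁻¹(ẑ,μ)` — with ONE `κ > 0`, `B ≥ 0` depending on
`(d, Lb, a′)` (PART 184's pair, the rate divided by `Lb`). [folklore] -/
theorem exists_flucCov_DelK_axial_inputs (hd : 1 ≤ d) (hs : Tendsto s atTop atTop) {a' : ℝ} (ha' : 0 < a') :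
    ∃ κ B : ℝ, 0 < κ ∧ 0 ≤ B ∧
      (∀ t k, EntryDecay (distK L (fine (Lb * 1) (cubic (d + 1) (s t)))) (((flucCov (reM (DelK (lev L k) (one_le_lev' L k) (fine (Lb * 1) (cubic (d + 1) (s t))) a ha)) (Matrix.fromRows (reM (QB 1 Lb (cubic (d + 1) (s t)))) (fun (t' : {x : Tor (fine (Lb * 1) (cubic (d + 1) (s t))) × Fin (d + 1) // (∀ ν, ν < x.2 → ((rem 1 Lb (cubic (d + 1) (s t)) x.1 ν : ℕ)) = 0) ∧ ((rem 1 Lb (cubic (d + 1) (s t)) x.1 x.2 : ℕ)) + 1 < Lb}) (x : Tor (fine (Lb * 1) (cubic (d + 1) (s t))) × Fin (d + 1)) => if x = (Function.Embedding.subtype (fun x : Tor (fine (Lb * 1) (cubic (d + 1) (s t))) × Fin (d + 1) => (∀ ν, ν < x.2 → ((rem 1 Lb (cubic (d + 1) (s t)) x.1 ν : ℕ)) = 0) ∧ ((rem 1 Lb (cubic (d + 1) (s t)) x.1 x.2 : ℕ)) + 1 < Lb)) t' then (1 : ℝ) else 0))).map ((↑) : ℝ → ℂ)).submatrix (unitIdx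 L (fine (Lb * 1) (cubic (d + 1) (s t)))) (unitIdx L (fine (Lb * 1) (cubic (d + 1) (s t))))) B κ) ∧
      (∀ t, TwoLevelDecayRate (distK L (fine (Lb * 1) (cubic (d + 1) (s t)))) (fun k => ((flucCov (reM (DelK (lev L k) (one_le_lev' L k) (fine (Lb * 1) (cubic (d + 1) (s t))) a ha)) (Matrix.fromRows (reM (QB 1 Lb (cubic (d + 1) (s t)))) (fun (t' : {x : Tor (fine (Lb * 1) (cubic (d + 1) (s t))) × Fin (d + 1) // (∀ ν, ν < x.2 → ((rem 1 Lb (cubic (d + 1) (s t)) x.1 ν : ℕ)) = 0) ∧ ((rem 1 Lb (cubic (d + 1) (s t)) x.1 x.2 : ℕ)) + 1 < Lb}) (x : Tor (fine (Lb * 1) (cubic (d + 1) (s t))) × Fin (d + 1)) => if x = (Function.Embedding.subtype (fun x : Tor (fine (Lb * 1) (cubic (d + 1) (s t))) × Fin (d + 1) => (∀ ν, ν < x.2 → ((rem 1 Lb (cubic (d + 1) (s t)) x.1 ν : ℕ)) = 0) ∧ ((rem 1 Lb (cubic (d + 1) (s t)) x.1 x.2 : ℕ)) + 1 < Lb)) t'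 then (1 : ℝ) else 0))).map ((↑) : ℝ → ℂ)).submatrix (unitIdx L (fine (Lb * 1) (cubic (d + 1) (s t)))) (unitIdx L (fine (Lb * 1) (cubic (d + 1) (s t))))) B κ (((L : ℝ) ^ 2)⁻¹)) ∧
      (∀ (k : ℕ) (μ ν : Fin (d + 1)) (z z' : Fin (d + 1) → ℤ), ∃ s' : ℂ,
        Tendsto (fun t => (((flucCov (reM (DelK (lev L k) (one_le_lev' L k) (fine (Lb * 1) (cubic (d + 1) (s t))) a ha)) (Matrix.fromRows (reM (QB 1 Lb (cubic (d + 1) (s t)))) (fun (t' : {x : Tor (fine (Lb * 1) (cubic (d + 1) (s t))) × Fin (d + 1) // (∀ ν, ν < x.2 → ((rem 1 Lb (cubic (d + 1) (s t)) x.1 ν : ℕ)) = 0) ∧ ((rem 1 Lb (cubic (d + 1) (s t)) x.1 x.2 : ℕ)) + 1 < Lb}) (x : Tor (fine (Lb * 1) (cubic (d + 1) (s t))) × Fin (d + 1)) => if x = (Function.Embedding.subtype (fun x : Tor (fine (Lb * 1) (cubic (d + 1) (s t))) × Fin (d + 1) => (∀ ν, ν < x.2 → ((rem 1 Lb (cubic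 (d + 1) (s t)) x.1 ν : ℕ)) = 0) ∧ ((rem 1 Lb (cubic (d + 1) (s t)) x.1 x.2 : ℕ)) + 1 < Lb)) t' then (1 : ℝ) else 0))).map ((↑) : ℝ → ℂ)).submatrix (unitIdx L (fine (Lb * 1) (cubic (d + 1) (s t)))) (unitIdx L (fine (Lb * 1) (cubic (d + 1) (s t))))) ((unitIdx L (fine (Lb * 1) (cubic (d + 1) (s t)))).symm (castT (fine (Lb * 1) (cubic (d + 1) (s t))) z, μ)) ((unitIdx L (fine (Lb * 1) (cubic (d + 1) (s t)))).symm (castT (fine (Lb * 1) (cubic (d + 1) (s t))) z', ν))) atTop (𝓝 s')) := by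
  have hLb : (0 : ℝ) < Lb := by exact_mod_cast Nat.pos_of_ne_zero (NeZero.ne Lb)
  have hL1 : (1 : ℝ) ≤ L := by exact_mod_cast Nat.one_le_iff_ne_zero.2 (NeZero.ne L)
  obtain ⟨κ, C, hκ, hC, H⟩ := flucCov_DelK_axial_two_levels Lb a ha hd ha'
  refine ⟨κ / Lb, C * Real.exp κ, div_pos hκ hLb, by positivity, fun t k x y => ?_, fun t k x y => ?_, fun k μ ν z z' => ?_⟩
  · -- (UD)
    rw [Matrix.submatrix_apply, Matrix.map_apply, Complex.norm_real, Real.norm_eq_abs, distK_eq_tdist_unitIdx]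
    refine ((H _ (lev L k) (lev L k) (one_le_lev' L k) (one_le_lev' L k) le_rfl _ _).1).trans ?_
    rw [mul_assoc]
    exact mul_le_mul_of_nonneg_left (exp_neg_tdist_par_le_exp_neg_tdist 1 Lb _ hκ.le _ _) hC.le
  · -- (SR): `n⁻² = (L⁻²)^k` along `n = L^k`, and `L^k ≤ L^{k+1}`
    have hkk : lev L k ≤ lev L (k + 1) := by
      have h := one_le_lev' L 1
      calc lev L k = 1 * lev L k := (one_mul _).symm
        _ ≤ L * lev L k := Nat.mul_le_mul_right _ (Nat.one_le_iff_ne_zero.2 (NeZero.ne L))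
        _ = lev L (k + 1) := (lev_succ' L k).symm
    simp only [Matrix.sub_apply, Matrix.submatrix_apply, Matrix.map_apply]
    rw [← Complex.ofReal_sub, Complex.norm_real, Real.norm_eq_abs, distK_eq_tdist_unitIdx]
    have h2 := (H _ (lev L k) (lev L (k + 1)) (one_le_lev' L k) (one_le_lev' L (k + 1)) hkk ((unitIdx L (fine (Lb * 1) (cubic (d + 1) (s t)))) x) ((unitIdx L (fine (Lb * 1) (cubic (d + 1) (s t)))) y)).2
    rw [Matrix.sub_apply] at h2
    refine h2.trans ?_
    rw [cast_lev', ← pow_mul, show k * 2 = 2 * k from mul_comm _ _, pow_mul, ← inv_pow, mul_assoc (C * Real.exp κ), mul_assoc C, mul_assoc C]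
    refine mul_le_mul_of_nonneg_left ?_ hC.le
    rw [mul_left_comm]
    refine mul_le_mul_of_nonneg_left (exp_neg_tdist_par_le_exp_neg_tdist 1 Lb _ hκ.le _ _) (by positivity)
  · -- EL₂
    obtain ⟨c, hc⟩ := exists_tendsto_flucCov_DelK_axial_castT Lb (lev L k) (one_le_lev' L k) a ha s hd hs ha' z μ z' ν
    refine ⟨(c : ℂ), ((Complex.continuous_ofReal.tendsto c).comp hc).congr fun t => ?_⟩
    simp only [Function.comp_apply, Matrix.submatrix_apply, Matrix.map_apply, Equiv.apply_symm_apply]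

end Inputs

end Summit.QuantumFields.BalabanUV.Beta.GAN24.OneStepConstraintAxialDelKInputTriple

end
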